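import Summits.ResolutionOfSingularities.ResolutionOfSingularities.Theorems.DeltaCutGrade2
import HarnessLib

/-!
# DeltaCutGradeCells — decomp-res node «GradeCut» (lens-6 g28, critic row 210 CLEARED (F-top eliminated; row-204
re-grant spent)), tree file 3/3 of the node

Content VERBATIM from the decomp-res lens-6 g28 node `HOME/decomp-res-lens-6/g28/GradeCut.lean` (pin 594c5539; no
carry, imports the landed `DeltaCutRefCells` + HarnessLib; namespace `…Theorems.DeltaCutClasses`); HOME =
run/shared/lean/pub/decomp-res; critic CRITIC-LEDGER row 210 CLEARED; landing orders NEXT-g29.md §4 + INBOX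
11:01:55Z — provenance, critic text and the lens header in full in the first file of the node, `DeltaCutGrade`.
`--kind proof --supports stmt-ResolutionOfSingularities-26971`.

## This file

§GCells — THE CELLS AND THE EXACT RE-LOCATION (plan file (A) cells; cn26 cells BY NAME, binders VERBATIM):
`WORTopRefHeavyGTame n` / `WORTopGHeavy n` (+ the `E1` families `E1TopRefHeavyGTame` [DECIDED:
`worTopRefHeavyGTame_of_five`, `e1TopRefHeavyGTame_of_five (h5 : E 5)`] and **`E1TopGHeavy`** [THE LOCATED RESIDUAL
of the lens-6 column after g28; cone-free HOME = this file]), the hyp-free carve `worTopRefHeavy_iff_gHeavy_gTame` /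
`e1TopRefHeavy_iff_gHeavy_gTame`, the RE-LOCATION `e1TopRefHeavy_iff_e1TopGHeavy (h5 : E 5)` and the column chain
`e1TopSepHeavy_iff_` / `e1TopRunHeavy_iff_` / `e1TopChainHeavy_iff_` / `e1TopDeltaHeavy_iff_` / `e1TopHeavy_iff_` /
`e1TopNoAbs_iff_e1TopGHeavy`, `e_one_iff_e1TopGHeavy (hSC) (h5)`; the residual's two kinds `WORTopGFrozen n`
[F-surf-sing · INHABITED by H] / `WORTopGPerpetual n` [P″ · UNDECIDED · no inhabitant] (+ `E1` families),
`worTopGHeavy_iff_surfSing_perpetual` (hyp-free), `worTopGHeavy_iff_intrinsic`.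

[WRITER NOTE (decomp-res writer g13): file split only (tree files ≤ 400 lines; the plan's section groups, cut
further by the cap at declaration boundaries); namespace, sections, section `open`s / `variable`s and every
declaration exactly as in the lens (the node's HOME-only dupNamespace-linter line is dropped — the library sets it;
`noncomputable section`, the two file-level `open` lines, `universe u` and the namespace-level `open
…TwistCutClasses` / `open …LightCutClasses` of the node are replayed in every file).]

(Sources: Hironaka1964; CossartJannsenSaito2020 Ch. 5–8; CossartPiltant2019 Prop. 2.6; Giraud1975; EGAIV2 §5–§6;
StacksProject 0BIQ / 035A / 0804; Matsumura1987 §28–§31; Kollar2007 §3.)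
-/

noncomputable section

open CategoryTheory CategoryTheory.Limits AlgebraicGeometry TopologicalSpace IsLocalRing
open Literature.AlgebraicGeometry.Resolution

universe u

namespace Summit.ResolutionOfSingularities.ResolutionOfSingularities.Theorems.DeltaCutClasses

open Summit.ResolutionOfSingularities.ResolutionOfSingularities.Theorems.TwistCutClasses
open Summit.ResolutionOfSingularities.ResolutionOfSingularities.Theorems.LightCutClasses

section GCells

open Summit.ResolutionOfSingularities.ResolutionOfSingularities.Theorems
open WeakOrderReduction ForcedTowerClasses SubfieldContactClasses AbsoluteContactClasses PurityValveClasses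

/-! ### §GCells — THE CELLS OF THE GRADED CUT: the EXACT hypothesis-free carve of `WORTopRefHeavy` / `E1TopRefHeavy` (binders
VERBATIM), the decided side PROVED from five, the RE-LOCATION of the residual, the edges down to `E 1`, and the
residual's two kinds
F-surf-sing / P″ -/

/-- **THE DECIDED CELL · `WORTopRefHeavyGTame n`** — weak resolution for g27's residual base data at marking `n` (canonical bad
run, separating run AND refined run not terminating) whose GRADED RUN TERMINATES.  DECIDED (PROVED below from
`SeqDimFour 5 n` by
`wor_of_gTerminates`; INHABITED by G₀ = `z³ + t⁴u²w²`, char 3: `GradeCutCertificates`). -/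
def WORTopRefHeavyGTame (n : ℕ) : Prop :=
  ∀ p : ℕ, p.Prime → ∀ (k : Type) [Field k] [CharP k p] (Y : Scheme.{0}) (g : Y ⟶ Spec (.of k)),
    IsBase Y g → ∀ M : MarkedIdeal Y, IsDatum n M → TopHeavy Y M.ideal n → TopDeltaHeavy Y M.ideal n →
      TopChainHeavy Y M.ideal n → ¬ RunTerminates n ⟨Y, M.ideal⟩ → ¬ SepTerminates n ⟨Y, M.ideal⟩ →
        ¬ RefTerminates n ⟨⟨Y, M.ideal⟩, none⟩ → GTerminates n ⟨⟨Y, M.ideal⟩, none⟩ → ∃ t : CentreSeq Y, WeakResolution t M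

/-- **THE RESIDUAL CELL · `WORTopGHeavy n`** — weak resolution for g27's residual base data at marking `n` whose GRADED RUN does
NOT terminate either (it FREEZES at a nonempty bad locus whose irregular non-curve reduced closure has an IRREGULAR
surface part —
kind F-surf-sing, INHABITED by H = `z³ + (t²w − u²)⁴` —, or is PERPETUAL — kind P″, no inhabitant known; exact:
`not_gTerminates_iff`).  RESIDUAL (the located successor of `WORTopRefHeavy n`). -/
def WORTopGHeavy (n : ℕ) : Prop :=
  ∀ p : ℕ, p.Prime → ∀ (k : Type) [Field k] [CharP k p] (Y : Scheme.{0}) (g : Y ⟶ Spec (.of k)),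
    IsBase Y g → ∀ M : MarkedIdeal Y, IsDatum n M → TopHeavy Y M.ideal n → TopDeltaHeavy Y M.ideal n →
      TopChainHeavy Y M.ideal n → ¬ RunTerminates n ⟨Y, M.ideal⟩ → ¬ SepTerminates n ⟨Y, M.ideal⟩ →
        ¬ RefTerminates n ⟨⟨Y, M.ideal⟩, none⟩ → ¬ GTerminates n ⟨⟨Y, M.ideal⟩, none⟩ → ∃ t : CentreSeq Y, WeakResolution t M

/-- **THE DECIDED family · `E1TopRefHeavyGTame`**. DECIDED. -/
def E1TopRefHeavyGTame : Prop := ∀ n : ℕ, 1 ≤ n → WORTopRefHeavyGTame n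

/-- **THE RESIDUAL (family) · `E1TopGHeavy`** — THE LOCATED RESIDUAL of the lens-6 column after g28. RESIDUAL. -/
def E1TopGHeavy : Prop := ∀ n : ℕ, 1 ≤ n → WORTopGHeavy n

/-- **EXACT CARVE at one marking** (hypothesis-free): `WORTopRefHeavy n ⟺ WORTopGHeavy n ∧ WORTopRefHeavyGTame n`
(excluded middle
on `GTerminates`). [new] [folklore] -/
theorem worTopRefHeavy_iff_gHeavy_gTame (n : ℕ) : WORTopRefHeavy n ↔ WORTopGHeavy n ∧ WORTopRefHeavyGTame n := by
  constructor
  · intro h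
    exact ⟨fun p hp k _ _ Y g hB M hM hT hD hC hr hs hf _ => h p hp k Y g hB M hM hT hD hC hr hs hf,
      fun p hp k _ _ Y g hB M hM hT hD hC hr hs hf _ => h p hp k Y g hB M hM hT hD hC hr hs hf⟩
  · rintro ⟨hR, hD⟩ p hp k _ _ Y g hB M hM hT hDH hC hr hs hf
    by_cases ht : GTerminates n ⟨⟨Y, M.ideal⟩, none⟩
    · exact hD p hp k Y g hB M hM hT hDH hC hr hs hf ht
    · exact hR p hp k Y g hB M hM hT hDH hC hr hs hf ht

/-- **EXACT CARVE of the family** (hypothesis-free): `E1TopRefHeavy ⟺ E1TopGHeavy ∧ E1TopRefHeavyGTame`. [new] [folklore] -/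
theorem e1TopRefHeavy_iff_gHeavy_gTame : E1TopRefHeavy ↔ E1TopGHeavy ∧ E1TopRefHeavyGTame := by
  constructor
  · intro h
    exact ⟨fun n hn => ((worTopRefHeavy_iff_gHeavy_gTame n).1 (h n hn)).1,
      fun n hn => ((worTopRefHeavy_iff_gHeavy_gTame n).1 (h n hn)).2⟩
  · rintro ⟨hR, hD⟩ n hn
    exact (worTopRefHeavy_iff_gHeavy_gTame n).2 ⟨hR n hn, hD n hn⟩

/-- **THE DECIDED CELL IS PROVED from `SeqDimFour 5 n`.** [new] [folklore] -/
theorem worTopRefHeavyGTame_of_five {n : ℕ} (hn : 1 ≤ n) (h5 : SeqDimFour 5 n) : WORTopRefHeavyGTame n :=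
  fun p hp k _ _ Y g hB M hM _ _ _ _ _ _ hG => wor_of_gTerminates hn h5 p hp k Y g hB M hM hG

/-- **THE DECIDED family is PROVED from `E 5`** (tree: `E 5` ⟸ CJS (R), `e_five_of_RCJS`). [new] [folklore] -/
theorem e1TopRefHeavyGTame_of_five (h5 : E 5) : E1TopRefHeavyGTame := fun n hn => worTopRefHeavyGTame_of_five hn (h5 n hn)

/-- **RE-LOCATION OF THE RESIDUAL (rule (C))**: under `E 5`, `E1TopRefHeavy ⟺ E1TopGHeavy` — g27's located residual
is EQUIVALENT
to its typed sub-class «the graded run does not terminate either», STRICTLY smaller as a class of data (G₀ is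
refined-FROZEN — kind
F-surface — and graded-DECIDED at g-height `2`: `GradeCutCertificates`). [new] [folklore] -/
theorem e1TopRefHeavy_iff_e1TopGHeavy (h5 : E 5) : E1TopRefHeavy ↔ E1TopGHeavy :=
  ⟨fun h => (e1TopRefHeavy_iff_gHeavy_gTame.1 h).1, fun h => e1TopRefHeavy_iff_gHeavy_gTame.2 ⟨h, e1TopRefHeavyGTame_of_five h5⟩⟩

/-- Per marking: under `SeqDimFour 5 n`, `WORTopRefHeavy n ⟺ WORTopGHeavy n`. [new] [folklore] -/
theorem worTopRefHeavy_iff_worTopGHeavy {n : ℕ} (hn : 1 ≤ n) (h5 : SeqDimFour 5 n) : WORTopRefHeavy n ↔ WORTopGHeavy n :=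
  ⟨fun h => ((worTopRefHeavy_iff_gHeavy_gTame n).1 h).1,
    fun h => (worTopRefHeavy_iff_gHeavy_gTame n).2 ⟨h, worTopRefHeavyGTame_of_five hn h5⟩⟩

/-- g26's residual: under `E 5`, `E1TopSepHeavy ⟺ E1TopGHeavy`. [new] [folklore] -/
theorem e1TopSepHeavy_iff_e1TopGHeavy (h5 : E 5) : E1TopSepHeavy ↔ E1TopGHeavy :=
  (e1TopSepHeavy_iff_e1TopRefHeavy h5).trans (e1TopRefHeavy_iff_e1TopGHeavy h5)

/-- Per marking: under `SeqDimFour 5 n`, `WORTopSepHeavy n ⟺ WORTopGHeavy n`. [new] [folklore] -/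
theorem worTopSepHeavy_iff_worTopGHeavy {n : ℕ} (hn : 1 ≤ n) (h5 : SeqDimFour 5 n) : WORTopSepHeavy n ↔ WORTopGHeavy n :=
  (worTopSepHeavy_iff_worTopRefHeavy hn h5).trans (worTopRefHeavy_iff_worTopGHeavy hn h5)

/-- g25's residual: under `E 5`, `E1TopRunHeavy ⟺ E1TopGHeavy`. [new] [folklore] -/
theorem e1TopRunHeavy_iff_e1TopGHeavy (h5 : E 5) : E1TopRunHeavy ↔ E1TopGHeavy :=
  (e1TopRunHeavy_iff_e1TopRefHeavy h5).trans (e1TopRefHeavy_iff_e1TopGHeavy h5)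

/-- g24's residual: under `E 5`, `E1TopChainHeavy ⟺ E1TopGHeavy`. [new] [folklore] -/
theorem e1TopChainHeavy_iff_e1TopGHeavy (h5 : E 5) : E1TopChainHeavy ↔ E1TopGHeavy :=
  (e1TopChainHeavy_iff_e1TopRefHeavy h5).trans (e1TopRefHeavy_iff_e1TopGHeavy h5)

/-- g23's residual: under `E 5`, `E1TopDeltaHeavy ⟺ E1TopGHeavy`. [new] [folklore] -/
theorem e1TopDeltaHeavy_iff_e1TopGHeavy (h5 : E 5) : E1TopDeltaHeavy ↔ E1TopGHeavy :=
  (e1TopDeltaHeavy_iff_e1TopRefHeavy h5).trans (e1TopRefHeavy_iff_e1TopGHeavy h5)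

/-- **THE WHOLE COLUMN after g28**: under `E 5`, `E1TopHeavy ⟺ E1TopGHeavy`. [new] [folklore] -/
theorem e1TopHeavy_iff_e1TopGHeavy (h5 : E 5) : E1TopHeavy ↔ E1TopGHeavy :=
  (e1TopHeavy_iff_e1TopRefHeavy h5).trans (e1TopRefHeavy_iff_e1TopGHeavy h5)

/-- **DOWN-LINK TO ITEM 26971's CLASS**: under `SubfieldContactAbs` and `E 5`, `E1TopNoAbs ⟺ E1TopGHeavy`. [new] [folklore] -/
theorem e1TopNoAbs_iff_e1TopGHeavy (hSC : SubfieldContactAbs) (h5 : E 5) : E1TopNoAbs ↔ E1TopGHeavy :=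
  (e1TopNoAbs_iff_e1TopRefHeavy hSC h5).trans (e1TopRefHeavy_iff_e1TopGHeavy h5)

/-- **SUMMIT EDGE after g28**: under `SubfieldContactAbs` and `E 5`, `E 1 ⟺ E1TopGHeavy` — the column's ONE open
statement is the
graded residual. [new] [folklore] -/
theorem e_one_iff_e1TopGHeavy (hSC : SubfieldContactAbs) (h5 : E 5) : E 1 ↔ E1TopGHeavy :=
  (e_one_iff_e1TopRefHeavy hSC h5).trans (e1TopRefHeavy_iff_e1TopGHeavy h5)

/-- **RESIDUAL SUB-CELL of KIND F-surf-sing · `WORTopGFrozen n`** — the graded run FREEZES: at its first motionless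
level nothing is
pending, the bad locus is NONEMPTY, its reduced closure is irregular, not a curve, and its SURFACE PART IS ITSELF IRREGULAR
(INHABITED: H = `z³ + (t²w − u²)⁴`, char 3, whose bad closure is a Whitney umbrella).  RESIDUAL (kind F-surf-sing). -/
def WORTopGFrozen (n : ℕ) : Prop :=
  ∀ p : ℕ, p.Prime → ∀ (k : Type) [Field k] [CharP k p] (Y : Scheme.{0}) (g : Y ⟶ Spec (.of k)),
    IsBase Y g → ∀ M : MarkedIdeal Y, IsDatum n M → TopHeavy Y M.ideal n → TopDeltaHeavy Y M.ideal n →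
      TopChainHeavy Y M.ideal n → ¬ RunTerminates n ⟨Y, M.ideal⟩ → ¬ SepTerminates n ⟨Y, M.ideal⟩ →
        ¬ RefTerminates n ⟨⟨Y, M.ideal⟩, none⟩ → GFrozen n ⟨⟨Y, M.ideal⟩, none⟩ → ∃ t : CentreSeq Y, WeakResolution t M

/-- **RESIDUAL SUB-CELL of KIND P″ · `WORTopGPerpetual n`** — the graded run is PERPETUAL (every level moves
forever; contains g27's
kind P′ by `RefPerpetual.gPerpetual`; no inhabitant known, none claimed).  RESIDUAL (kind P″). -/
def WORTopGPerpetual (n : ℕ) : Prop :=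
  ∀ p : ℕ, p.Prime → ∀ (k : Type) [Field k] [CharP k p] (Y : Scheme.{0}) (g : Y ⟶ Spec (.of k)),
    IsBase Y g → ∀ M : MarkedIdeal Y, IsDatum n M → TopHeavy Y M.ideal n → TopDeltaHeavy Y M.ideal n →
      TopChainHeavy Y M.ideal n → ¬ RunTerminates n ⟨Y, M.ideal⟩ → ¬ SepTerminates n ⟨Y, M.ideal⟩ →
        ¬ RefTerminates n ⟨⟨Y, M.ideal⟩, none⟩ → GPerpetual n ⟨⟨Y, M.ideal⟩, none⟩ → ∃ t : CentreSeq Y, WeakResolution t M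

/-- RESIDUAL kind-F-surf-sing family. RESIDUAL. -/
def E1TopGFrozen : Prop := ∀ n : ℕ, 1 ≤ n → WORTopGFrozen n

/-- RESIDUAL kind-P″ family. RESIDUAL. -/
def E1TopGPerpetual : Prop := ∀ n : ℕ, 1 ≤ n → WORTopGPerpetual n

/-- **EXACT CARVE OF THE RESIDUAL INTO ITS TWO KINDS** (hypothesis-free; `g_trichotomy` + exclusivity):
`WORTopGHeavy n ⟺ WORTopGFrozen n ∧ WORTopGPerpetual n`. [new] [folklore] -/
theorem worTopGHeavy_iff_surfSing_perpetual (n : ℕ) : WORTopGHeavy n ↔ WORTopGFrozen n ∧ WORTopGPerpetual n := by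
  constructor
  · intro h
    exact ⟨fun p hp k _ _ Y g hB M hM hT hD hC hr hs hf hF =>
        h p hp k Y g hB M hM hT hD hC hr hs hf ((not_gTerminates_iff n ⟨⟨Y, M.ideal⟩, none⟩).2 (Or.inl hF)),
      fun p hp k _ _ Y g hB M hM hT hD hC hr hs hf hP =>
        h p hp k Y g hB M hM hT hD hC hr hs hf ((not_gTerminates_iff n ⟨⟨Y, M.ideal⟩, none⟩).2 (Or.inr hP))⟩
  · rintro ⟨hF, hP⟩ p hp k _ _ Y g hB M hM hT hD hC hr hs hf ht
    rcases (not_gTerminates_iff n ⟨⟨Y, M.ideal⟩, none⟩).1 ht with h | h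
    · exact hF p hp k Y g hB M hM hT hD hC hr hs hf h
    · exact hP p hp k Y g hB M hM hT hD hC hr hs hf h

/-- the same for the families: `E1TopGHeavy ⟺ E1TopGFrozen ∧ E1TopGPerpetual`. [new] [folklore] -/
theorem e1TopGHeavy_iff_surfSing_perpetual : E1TopGHeavy ↔ E1TopGFrozen ∧ E1TopGPerpetual := by
  constructor
  · intro h
    exact ⟨fun n hn => ((worTopGHeavy_iff_surfSing_perpetual n).1 (h n hn)).1,
      fun n hn => ((worTopGHeavy_iff_surfSing_perpetual n).1 (h n hn)).2⟩
  · rintro ⟨hF, hP⟩ n hn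
    exact (worTopGHeavy_iff_surfSing_perpetual n).2 ⟨hF n hn, hP n hn⟩

/-- **THE RESIDUAL READ INTRINSICALLY**: `WORTopGHeavy n` is weak resolution for ALL base `n`-data whose canonical bad run,
separating run, refined run AND graded run all fail to terminate — the three g23–g25 heaviness binders are implied. [new]
[folklore] -/
theorem worTopGHeavy_iff_intrinsic {n : ℕ} (hn : 1 ≤ n) :
    WORTopGHeavy n ↔
      ∀ p : ℕ, p.Prime → ∀ (k : Type) [Field k] [CharP k p] (Y : Scheme.{0}) (g : Y ⟶ Spec (.of k)),
        IsBase Y g → ∀ M : MarkedIdeal Y, IsDatum n M → ¬ RunTerminates n ⟨Y, M.ideal⟩ → ¬ SepTerminates n ⟨Y, M.ideal⟩ →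
          ¬ RefTerminates n ⟨⟨Y, M.ideal⟩, none⟩ → ¬ GTerminates n ⟨⟨Y, M.ideal⟩, none⟩ →
            ∃ t : CentreSeq Y, WeakResolution t M := by
  constructor
  · intro h p hp k _ _ Y g hB M hM hr hs hf hg
    haveI : IsLocallyNoetherian Y := isLocallyNoetherian_of_isBase hB
    have hC : TopChainHeavy Y M.ideal n := topChainHeavy_of_not_runTerminates hr
    have hD : TopDeltaHeavy Y M.ideal n := topDeltaHeavy_of_topChainHeavy hp hB hn hM hC
    exact h p hp k Y g hB M hM (topHeavy_of_topDeltaHeavy hD) hD hC hr hs hf hg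
  · intro h p hp k _ _ Y g hB M hM _ _ _ hr hs hf hg
    exact h p hp k Y g hB M hM hr hs hf hg

/-- **THE GRADED TERMINATION TESTS SUBSUME THE REFINED ONES**: `¬ GTerminates ⟹ ¬ RefTerminates` — so the residual binder
`¬ RefTerminates` of `WORTopGHeavy` is implied by `¬ GTerminates` (kept VERBATIM for the carve). [new] [folklore] -/
theorem not_refTerminates_of_not_gTerminates {n : ℕ} {R : RefStage} (h : ¬ GTerminates n R) : ¬ RefTerminates n R :=
  fun hr => h hr.gTerminates

/-- **g27's KIND F-surface SPLITS EXACTLY: F-top IS ABSORBED BY THE DECIDED + P″ + F-surf-sing CELLS (the sub-kind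
F-top is EMPTY
as a graded letter)**: a refined-FROZEN stage whose frozen level has a REGULAR surface part has a graded run that MOVES at the
frozen level (the graded blow-up) — so it is graded-terminating, graded-frozen at a LATER level with irregular surface part, or
graded-perpetual, never «frozen with a regular surface part». [new] [folklore] -/
theorem refFrozen_top_gMoves' {n : ℕ} {N : Stage} {h : ℕ} (hpre : ∀ j < h, RefMoves n (refRun n ⟨N, none⟩ j))
    (hP : (refRun n ⟨N, none⟩ h).pending = none) (hT : TopFrozen n (refRun n ⟨N, none⟩ h).base) :
    GMoves n (gRun n ⟨N, none⟩ h) :=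
  (refFrozen_top_gMoves hpre hP hT).1

end GCells

end Summit.ResolutionOfSingularities.ResolutionOfSingularities.Theorems.DeltaCutClasses
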